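import Mathlib
import Literature.NumberTheory.Sieve.LinearEquationsInPrimesProofs
import Literature.NumberTheory.Sieve.LinearEquationsInPrimesDimOne

/-!
# Green–Tao normalisation in dimension one, I: substitutions `n ↦ u n + c`
# (crux `PairsToGHL`, stmt-Parity-9389, line `sloped_ladder`, stub `stub_toBounded`)

Algebraic bookkeeping for the deduction "elementary Hardy–Littlewood for every fixed POSITIVE
one-dimensional system on `n ∈ [1, N]`" ⇒ `BoundedDickson` (Green–Tao 2010, (1.2)–(1.4) for
`d = 1`).  For a system `Φ : Fin t → AffLinForm 1`, `ψᵢ(n) = aᵢ n + bᵢ` (`aᵢ = (Φ i).coeff 0`,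
`bᵢ = (Φ i).const`), the tuple weight is `F_Φ(n) = ∏ᵢ Λ(aᵢ n + bᵢ)` and the positivity set is
`P_Φ = {r ∈ ℝ : aᵢ r + bᵢ > 0 ∀ i}` (both written out explicitly below; no definitions):

* `F_Φ ≥ 0` vanishes at integers outside `P_Φ`; `P_Φ` is an interval, bounded below (above) by
  `∓|bⱼ|` in the direction of a form of positive (negative) slope;
* a *substituted system* `Ψ`, `Ψᵢ(n) = ψᵢ(u n + c)` — characterised by its coefficients
  `(Ψ i).coeff 0 = u aᵢ`, `(Ψ i).const = aᵢ c + bᵢ` — is again non-degenerate for `u = ±1`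
  (`isNondegenerateSystem_subst`) and has the SAME local factors at every prime
  (`localFactor_subst`: `v ↦ u v + c` permutes `ℤ/p`), hence the same singular product
  (`singularProduct_subst`);
* `shifted_estimate` — the ladder hypothesis, applied to the substitution `n ↦ u n + u c`, in the
  uniform form `|∑_{c < n ≤ c + M} F_Φ(u n) − 𝔖(Φ) M| ≤ η M + C_η` for all `M`.

References: B. Green, T. Tao, *Linear equations in primes*, Ann. of Math. 171 (2010), (1.2)–(1.7).
-/

namespace Summit.Parity.GeneralizedHardyLittlewood.Theorems.PairsToGHL.SlopedLadder

namespace ToBounded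

open Finset Filter
open scoped ArithmeticFunction.vonMangoldt
open Literature.NumberTheory.Sieve

noncomputable section

variable {t : ℕ}

/-! ### The tuple weight and the positivity set -/

/-- `ψ(n) = a n + b` on the vector `![n]`. [folklore] -/
theorem eval_vecOne (ψ : AffLinForm 1) (n : ℤ) : ψ.eval ![n] = ψ.coeff 0 * n + ψ.const := by
  simp [AffLinForm.eval]

/-- The tuple weight `∏ᵢ Λ(aᵢ n + bᵢ)` is non-negative. [folklore] -/
theorem tupleWeight_nonneg (Φ : Fin t → AffLinForm 1) (n : ℤ) :
    0 ≤ ∏ i, intVonMangoldt ((Φ i).coeff 0 * n + (Φ i).const) :=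
  Finset.prod_nonneg fun _ _ => ArithmeticFunction.vonMangoldt_nonneg

/-- The tuple weight vanishes as soon as one form is `≤ 0` (`Λ = 0` on `ℤ_{≤ 0}`). [folklore] -/
theorem tupleWeight_eq_zero_of_nonpos (Φ : Fin t → AffLinForm 1) {n : ℤ} {i : Fin t}
    (h : (Φ i).coeff 0 * n + (Φ i).const ≤ 0) :
    ∏ i, intVonMangoldt ((Φ i).coeff 0 * n + (Φ i).const) = 0 := by
  refine Finset.prod_eq_zero (Finset.mem_univ i) ?_
  rw [intVonMangoldt, Int.toNat_eq_zero.mpr h, ArithmeticFunction.map_zero]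

/-- The tuple weight is supported on the positivity set `{r : aᵢ r + bᵢ > 0 ∀ i}`. [folklore] -/
theorem tupleWeight_eq_zero_of_not_mem (Φ : Fin t → AffLinForm 1) {n : ℤ}
    (hn : (n : ℝ) ∉ {r : ℝ | ∀ i, 0 < ((Φ i).coeff 0 : ℝ) * r + ((Φ i).const : ℝ)}) :
    ∏ i, intVonMangoldt ((Φ i).coeff 0 * n + (Φ i).const) = 0 := by
  simp only [Set.mem_setOf_eq, not_forall, not_lt] at hn
  obtain ⟨i, hi⟩ := hn
  refine tupleWeight_eq_zero_of_nonpos Φ (i := i) ?_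
  exact_mod_cast hi

/-- The positivity set is an interval. [folklore] -/
theorem ordConnected_posSet (Φ : Fin t → AffLinForm 1) :
    ({r : ℝ | ∀ i, 0 < ((Φ i).coeff 0 : ℝ) * r + ((Φ i).const : ℝ)}).OrdConnected := by
  refine ⟨fun x hx y hy z hz i => ?_⟩
  rcases le_or_gt 0 ((Φ i).coeff 0 : ℝ) with ha | ha
  · have := mul_le_mul_of_nonneg_left hz.1 ha
    linarith [hx i]
  · have := mul_le_mul_of_nonpos_left hz.2 ha.le
    linarith [hy i]

/-- Integer points of the positivity set lie above `-|bⱼ|` in the direction `u` of a form with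
`u aⱼ > 0` (`u = ±1`). [folklore] -/
theorem lt_mul_of_mem_posSet (Φ : Fin t → AffLinForm 1) {u : ℤ} (hu : u = 1 ∨ u = -1) {j : Fin t}
    (hj : 0 < u * (Φ j).coeff 0) {m : ℤ}
    (hm : (m : ℝ) ∈ {r : ℝ | ∀ i, 0 < ((Φ i).coeff 0 : ℝ) * r + ((Φ i).const : ℝ)}) :
    -|(Φ j).const| < u * m := by
  have h : 0 < (Φ j).coeff 0 * m + (Φ j).const := by exact_mod_cast hm j
  rcases hu with rfl | rfl
  · rw [one_mul] at hj ⊢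
    by_contra hcon
    push Not at hcon
    have hm0 : m ≤ 0 := le_trans hcon (neg_nonpos.mpr (abs_nonneg _))
    have h1 : (Φ j).coeff 0 * m ≤ m := by nlinarith
    linarith [neg_abs_le ((Φ j).const), le_abs_self ((Φ j).const)]
  · rw [neg_one_mul] at hj ⊢
    by_contra hcon
    push Not at hcon
    have hm0 : 0 ≤ m := le_trans (abs_nonneg _) (by linarith)
    have h1 : (Φ j).coeff 0 * m ≤ -m := by nlinarith
    linarith [neg_abs_le ((Φ j).const), le_abs_self ((Φ j).const)]

/-- Real points of the positivity set lie in `(-|bᵢ|, |bⱼ|)` when `aᵢ > 0 > aⱼ`. [folklore] -/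
theorem mem_Ioo_of_mem_posSet (Φ : Fin t → AffLinForm 1) {i j : Fin t} (hi : 0 < (Φ i).coeff 0)
    (hj : (Φ j).coeff 0 < 0) {r : ℝ}
    (hr : r ∈ {r : ℝ | ∀ i, 0 < ((Φ i).coeff 0 : ℝ) * r + ((Φ i).const : ℝ)}) :
    -|((Φ i).const : ℝ)| < r ∧ r < |((Φ j).const : ℝ)| := by
  have hai : (1 : ℝ) ≤ (Φ i).coeff 0 := by exact_mod_cast (show (1 : ℤ) ≤ (Φ i).coeff 0 by omega)
  have haj : ((Φ j).coeff 0 : ℝ) ≤ -1 := by exact_mod_cast (show (Φ j).coeff 0 ≤ -1 by omega)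
  have h1 := hr i
  have h2 := hr j
  constructor
  · by_contra hcon
    push Not at hcon
    have hr0 : r ≤ 0 := le_trans hcon (neg_nonpos.mpr (abs_nonneg _))
    have : ((Φ i).coeff 0 : ℝ) * r ≤ r := by nlinarith
    linarith [le_abs_self ((Φ i).const : ℝ)]
  · by_contra hcon
    push Not at hcon
    have hr0 : 0 ≤ r := le_trans (abs_nonneg _) hcon
    have : ((Φ j).coeff 0 : ℝ) * r ≤ -r := by nlinarith
    linarith [le_abs_self ((Φ j).const : ℝ)]

/-- A non-degenerate one-dimensional form has `a ≠ 0`. [cite: GreenTao2010, Def. 1.1] -/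
theorem coeff_zero_ne_zero {Φ : Fin t → AffLinForm 1} (hΦ : IsNondegenerateSystem Φ) (i : Fin t) :
    (Φ i).coeff 0 ≠ 0 := by
  intro h
  apply hΦ.1 i
  funext j
  rw [Fin.fin_one_eq_zero j, h]
  rfl

/-! ### The substitution `n ↦ u n + c`

A substituted system `Ψ` (`Ψᵢ(n) = ψᵢ(u n + c)`) is any system with slopes `u aᵢ` and
constants `aᵢ c + bᵢ`; we characterise it by these two equations. -/

/-- `Ψᵢ(n) = ψᵢ(u n₀ + c)`. [folklore] -/
theorem subst_eval {Φ Ψ : Fin t → AffLinForm 1} {u c : ℤ}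
    (hΨ : ∀ i, (Ψ i).coeff 0 = u * (Φ i).coeff 0 ∧ (Ψ i).const = (Φ i).coeff 0 * c + (Φ i).const)
    (i : Fin t) (n : Fin 1 → ℤ) : (Ψ i).eval n = (Φ i).coeff 0 * (u * n 0 + c) + (Φ i).const := by
  rw [DimOne.eval_eq, (hΨ i).1, (hΨ i).2]
  ring

/-- For `u = ±1` a substituted system is again non-degenerate (the substitution is invertible
on `ℤ`). [cite: GreenTao2010, Def. 1.1] -/
theorem isNondegenerateSystem_subst {Φ Ψ : Fin t → AffLinForm 1} (hΦ : IsNondegenerateSystem Φ)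
    {u c : ℤ} (hu : u = 1 ∨ u = -1)
    (hΨ : ∀ i, (Ψ i).coeff 0 = u * (Φ i).coeff 0 ∧ (Ψ i).const = (Φ i).coeff 0 * c + (Φ i).const) :
    IsNondegenerateSystem Ψ := by
  have hu2 : u * u = 1 := by rcases hu with rfl | rfl <;> norm_num
  have hu0 : u ≠ 0 := by rcases hu with rfl | rfl <;> norm_num
  refine ⟨fun i h => ?_, fun i j hij a b hab => ?_⟩
  · have h0 := congrFun h 0
    rw [(hΨ i).1, Pi.zero_apply, mul_eq_zero] at h0
    rcases h0 with h0 | h0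
    · exact hu0 h0
    · exact coeff_zero_ne_zero hΦ i h0
  · refine hΦ.2 i j hij a b fun n => ?_
    have key := hab (fun _ => u * (n 0 - c))
    simp only [subst_eval hΨ] at key
    have hn : u * (u * (n 0 - c)) + c = n 0 := by rw [← mul_assoc, hu2]; ring
    rw [hn] at key
    rw [DimOne.eval_eq, DimOne.eval_eq]
    exact key

/-- Reduction mod `p` of the substituted forms: `Ψᵢ,ₚ(v) = ψᵢ,ₚ(u v₀ + c)`. [folklore] -/
theorem modEval_subst {Φ Ψ : Fin t → AffLinForm 1} {u c : ℤ}
    (hΨ : ∀ i, (Ψ i).coeff 0 = u * (Φ i).coeff 0 ∧ (Ψ i).const = (Φ i).coeff 0 * c + (Φ i).const)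
    (i : Fin t) (p : ℕ) (v : Fin 1 → ZMod p) :
    (Ψ i).modEval p v = (Φ i).modEval p (fun _ => (u : ZMod p) * v 0 + (c : ZMod p)) := by
  simp only [AffLinForm.modEval, Fin.sum_univ_one, (hΨ i).1, (hΨ i).2, Int.cast_mul, Int.cast_add]
  ring

/-- `v ↦ u v + c` permutes `ℤ/p` (`u = ±1`), so the good residues are equinumerous. [folklore] -/
theorem goodCount_subst {Φ Ψ : Fin t → AffLinForm 1} {u c : ℤ} (hu : u = 1 ∨ u = -1)
    (hΨ : ∀ i, (Ψ i).coeff 0 = u * (Φ i).coeff 0 ∧ (Ψ i).const = (Φ i).coeff 0 * c + (Φ i).const)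
    (p : ℕ) [NeZero p] : goodCount Ψ p = goodCount Φ p := by
  have hu2 : (u : ZMod p) * (u : ZMod p) = 1 := by
    rcases hu with rfl | rfl <;> push_cast <;> ring
  unfold goodCount
  refine Finset.card_nbij' (fun v _ => (u : ZMod p) * v 0 + (c : ZMod p))
    (fun w _ => (u : ZMod p) * (w 0 - (c : ZMod p))) (fun v hv => ?_) (fun w hw => ?_)
    (fun v _ => ?_) (fun w _ => ?_)
  · simp only [Finset.coe_filter, Finset.mem_univ, true_and, Set.mem_setOf_eq,
      modEval_subst hΨ] at hv ⊢
    exact hv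
  · simp only [Finset.coe_filter, Finset.mem_univ, true_and, Set.mem_setOf_eq,
      modEval_subst hΨ] at hw ⊢
    have : (fun _ : Fin 1 => (u : ZMod p) * ((u : ZMod p) * (w 0 - (c : ZMod p))) + (c : ZMod p)) = w := by
      funext j
      rw [Fin.fin_one_eq_zero j, ← mul_assoc, hu2]
      ring
    rw [this]
    exact hw
  · funext j
    rw [Fin.fin_one_eq_zero j]
    simp only
    rw [add_sub_cancel_right, ← mul_assoc, hu2, one_mul]
  · funext j
    rw [Fin.fin_one_eq_zero j]
    simp only
    rw [← mul_assoc, hu2, one_mul, sub_add_cancel]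

/-- **Local factors are substitution-invariant**: `β_p(Ψ) = β_p(Φ)` for every prime `p` and
`u = ±1`. [cite: GreenTao2010, (1.6)] -/
theorem localFactor_subst {Φ Ψ : Fin t → AffLinForm 1} {u c : ℤ} (hu : u = 1 ∨ u = -1)
    (hΨ : ∀ i, (Ψ i).coeff 0 = u * (Φ i).coeff 0 ∧ (Ψ i).const = (Φ i).coeff 0 * c + (Φ i).const)
    {p : ℕ} (hp : p.Prime) : localFactor Ψ p = localFactor Φ p := by
  haveI := Fact.mk hp
  rw [localFactor_prime, localFactor_prime, goodCount_subst hu hΨ p]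

/-- **The singular product is substitution-invariant**: `𝔖(Ψ) = 𝔖(Φ)` for `u = ±1` (equality of
the ordered limits of equal partial products; no convergence needed). [cite: GreenTao2010, (1.7)] -/
theorem singularProduct_subst {Φ Ψ : Fin t → AffLinForm 1} {u c : ℤ} (hu : u = 1 ∨ u = -1)
    (hΨ : ∀ i, (Ψ i).coeff 0 = u * (Φ i).coeff 0 ∧ (Ψ i).const = (Φ i).coeff 0 * c + (Φ i).const) :
    singularProduct Ψ = singularProduct Φ := by
  unfold singularProduct
  have : singularProductPartial Ψ = singularProductPartial Φ := by
    funext x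
    unfold singularProductPartial
    exact Finset.prod_congr rfl fun p hp => localFactor_subst hu hΨ (Nat.mem_primesLE.mp hp).2
  rw [this]

/-! ### The ladder hypothesis in uniform form -/

/-- From `f = o(N)`: for every `η > 0` there is `C` with `|f(M)| ≤ η M + C` for ALL `M`. [folklore] -/
theorem exists_uniform_of_isLittleO {f : ℕ → ℝ} (h : f =o[atTop] fun N : ℕ => (N : ℝ)) {η : ℝ}
    (hη : 0 < η) : ∃ C : ℝ, ∀ M : ℕ, |f M| ≤ η * M + C := by
  obtain ⟨N₁, hN₁⟩ := eventually_atTop.mp (h.def hη)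
  refine ⟨∑ N ∈ Finset.range N₁, |f N|, fun M => ?_⟩
  have hsum : 0 ≤ ∑ N ∈ Finset.range N₁, |f N| := Finset.sum_nonneg fun _ _ => abs_nonneg _
  have hM0 : 0 ≤ η * M := by positivity
  rcases lt_or_ge M N₁ with hM | hM
  · have h1 : |f M| ≤ ∑ N ∈ Finset.range N₁, |f N| :=
      Finset.single_le_sum (f := fun N => |f N|) (fun _ _ => abs_nonneg _) (Finset.mem_range.mpr hM)
    linarith
  · have h1 := hN₁ M hM
    simp only [Real.norm_eq_abs, Nat.abs_cast] at h1
    linarith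

/-- `∑_{m=1}^{M} f(m + c) = ∑_{c < n ≤ c + M} f(n)` (`ℕ`-indexed to `ℤ`-indexed). [folklore] -/
theorem sum_Icc_nat_shift (f : ℤ → ℝ) (c : ℤ) (M : ℕ) :
    ∑ m ∈ Finset.Icc 1 M, f ((m : ℤ) + c) = ∑ n ∈ Finset.Ioc c (c + M), f n := by
  refine Finset.sum_nbij' (fun m : ℕ => (m : ℤ) + c) (fun n : ℤ => (n - c).toNat) (fun m hm => ?_)
    (fun n hn => ?_) (fun m _ => by simp) (fun n hn => ?_) (fun m _ => rfl)
  · simp only [Finset.mem_Icc, Finset.mem_Ioc] at hm ⊢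
    omega
  · simp only [Finset.mem_Icc, Finset.mem_Ioc] at hn ⊢
    omega
  · simp only [Finset.mem_Ioc] at hn
    omega

/-- **The ladder hypothesis after the substitution `n ↦ u n + u c`.** If `u = ±1`, all `u aᵢ > 0`
and all `u aᵢ c + bᵢ ≥ 0`, then for every `η > 0` there is `C` with
`|∑_{c < n ≤ c + M} F_Φ(u n) − 𝔖(Φ) M| ≤ η M + C` for all `M` (the singular product of the
substituted system being `𝔖(Φ)`). [cite: GreenTao2010, (1.2)-(1.4)] -/
theorem shifted_estimate
    (H : ∀ t : ℕ, 1 ≤ t → ∀ Φ : Fin t → AffLinForm 1, IsNondegenerateSystem Φ →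
      (∀ i, 0 < (Φ i).coeff 0 ∧ 0 ≤ (Φ i).const) →
        ((fun N : ℕ => ∑ n ∈ Finset.Icc 1 N, ∏ i, intVonMangoldt ((Φ i).eval ![(n : ℤ)]) -
            singularProduct Φ * N) =o[atTop] fun N : ℕ => (N : ℝ)))
    (ht : 1 ≤ t) {Φ : Fin t → AffLinForm 1} (hΦ : IsNondegenerateSystem Φ) {u : ℤ}
    (hu : u = 1 ∨ u = -1) {c : ℤ}
    (hpos : ∀ i, 0 < u * (Φ i).coeff 0 ∧ 0 ≤ u * (Φ i).coeff 0 * c + (Φ i).const) {η : ℝ}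
    (hη : 0 < η) :
    ∃ C : ℝ, ∀ M : ℕ,
      |∑ n ∈ Finset.Ioc c (c + M), ∏ i, intVonMangoldt ((Φ i).coeff 0 * (u * n) + (Φ i).const) -
          singularProduct Φ * M| ≤ η * M + C := by
  -- the substituted system `Ψᵢ(n) = ψᵢ(u n + u c)`
  set Ψ : Fin t → AffLinForm 1 := fun i => ⟨fun _ => u * (Φ i).coeff 0, (Φ i).coeff 0 * (u * c) + (Φ i).const⟩
    with hΨ_def
  have hΨ : ∀ i, (Ψ i).coeff 0 = u * (Φ i).coeff 0 ∧ (Ψ i).const = (Φ i).coeff 0 * (u * c) + (Φ i).const :=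
    fun i => ⟨rfl, rfl⟩
  have hpos' : ∀ i, 0 < (Ψ i).coeff 0 ∧ 0 ≤ (Ψ i).const := by
    intro i
    rw [(hΨ i).1, (hΨ i).2]
    refine ⟨(hpos i).1, ?_⟩
    linarith [(hpos i).2, show (Φ i).coeff 0 * (u * c) = u * (Φ i).coeff 0 * c by ring]
  have h := H t ht Ψ (isNondegenerateSystem_subst hΦ hu hΨ) hpos'
  rw [singularProduct_subst hu hΨ] at h
  have hterm : ∀ n : ℤ, ∏ i, intVonMangoldt ((Ψ i).eval ![n]) =
      ∏ i, intVonMangoldt ((Φ i).coeff 0 * (u * (n + c)) + (Φ i).const) := by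
    intro n
    refine Finset.prod_congr rfl fun i _ => ?_
    rw [eval_vecOne, (hΨ i).1, (hΨ i).2]
    congr 1
    ring
  have hsum : ∀ M : ℕ, ∑ n ∈ Finset.Icc 1 M, ∏ i, intVonMangoldt ((Ψ i).eval ![(n : ℤ)]) =
      ∑ n ∈ Finset.Ioc c (c + M), ∏ i, intVonMangoldt ((Φ i).coeff 0 * (u * n) + (Φ i).const) := by
    intro M
    simp_rw [hterm]
    exact sum_Icc_nat_shift (fun n => ∏ i, intVonMangoldt ((Φ i).coeff 0 * (u * n) + (Φ i).const)) c M
  obtain ⟨C, hC⟩ := exists_uniform_of_isLittleO h hη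
  refine ⟨C, fun M => ?_⟩
  have := hC M
  simp only [hsum] at this
  exact this

end

end ToBounded

/-! ### Registered sub-goal of this helper file -/

/-- **Part 1 of `stub_toBounded` (registered sub-goal `stub_toBounded_part1`).** The ladder
hypothesis after the substitution `n ↦ u n + u c` (`u = ±1`, positive substituted system), in the
uniform form `|∑_{c < n ≤ c + M} F_Φ(u n) − 𝔖(Φ) M| ≤ η M + C_η` for all `M`.
[cite: GreenTao2010, (1.2)-(1.4)] -/
theorem stub_toBounded_part1 :
    (∀ t : ℕ, 1 ≤ t → ∀ Φ : Fin t → Literature.NumberTheory.Sieve.AffLinForm 1, Literature.NumberTheory.Sieve.IsNondegenerateSystem Φ → (∀ i, 0 < (Φ i).coeff 0 ∧ 0 ≤ (Φ i).const) → ((fun N : ℕ => ∑ n ∈ Finset.Icc 1 N, ∏ i, Literature.NumberTheory.Sieve.intVonMangoldt ((Φ i).eval ![(n : ℤ)]) - Literature.NumberTheory.Sieve.singularProduct Φ * N) =o[Filter.atTop] fun N : ℕ => (N : ℝ))) → ∀ (t : ℕ) (Φ : Fin t → Literature.NumberTheory.Sieve.AffLinForm 1) (u c : ℤ), 1 ≤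 t → Literature.NumberTheory.Sieve.IsNondegenerateSystem Φ → (u = 1 ∨ u = -1) → (∀ i, 0 < u * (Φ i).coeff 0 ∧ 0 ≤ u * (Φ i).coeff 0 * c + (Φ i).const) → ∀ η : ℝ, 0 < η → ∃ C : ℝ, ∀ M : ℕ, |∑ n ∈ Finset.Ioc c (c + M), ∏ i, Literature.NumberTheory.Sieve.intVonMangoldt ((Φ i).coeff 0 * (u * n) + (Φ i).const) - Literature.NumberTheory.Sieve.singularProduct Φ * M| ≤ η * M + C :=
  fun H _ _ _ _ ht hΦ hu hpos _ hη => ToBounded.shifted_estimate H ht hΦ hu hpos hη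

end Summit.Parity.GeneralizedHardyLittlewood.Theorems.PairsToGHL.SlopedLadder
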